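import Summits.ValiantsHypothesis.ValiantsHypothesis.Theorems.DivisionGapPerCofactorDegreeReductionWindowGlue
import Summits.ValiantsHypothesis.ValiantsHypothesis.Theorems.DivisionGapPerCofactorDegreeReductionStubContentSplit
import Summits.ValiantsHypothesis.ValiantsHypothesis.Theorems.DivisionGapPerCofactorDegreeReductionStubMonomialStripping
import Summits.ValiantsHypothesis.ValiantsHypothesis.Theorems.DivisionGapPerCofactorDegreeReductionStubAutomaticPositivity
import Summits.ValiantsHypothesis.ValiantsHypothesis.Theorems.DivisionGapPerMultiplesHardStubMultihomogeneousNormalForm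

/-!
# Crux `DivisionGap.PerCofactorDegreeReduction` (stmt-ValiantsHypothesis-15046), line `Sketch` —
# the WINDOW of the crux, part 3: the line's composition with its two open stubs as hypotheses

Line `Sketch` (cards prime-walk-positivizer + abc-tower-collapse) splits the crux into
K1 (creation degree: a cheap nonnegative element of the ideal `(per_n) ⊂ ℝ[x]` of quasi-polynomial
degree, SIGNED cofactor allowed) and K2 (cheap positivization of the signed cofactor).  After the
cycle-2 reshape both are stated on their contentful WINDOW only; everything else is proved.  This
file records the composition as a closed theorem of the tree:

* `creationDegree_of_window` — K1|window ⇒ K1 (regimes: `A := per_n`; the free bottom slice;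
  free single-typing; polynomial content stripping; the window), bookkeeping `Window.qp_absorb`.
* `cheapPositivization_of_window` — K2|window ⇒ K2 (outside the window `p := per_n` positivizes).
* `perCofactorDegreeReduction_of_windows` — **K1|window → K2|window → PerCofactorDegreeReduction**.
With `Window.creationDegreeWindow_of_perCofactorDegreeReduction` (K1|window is necessary) this
sandwiches the line's open stub K1|window between the crux and the crux given K2|window.

Line lead prover-line-stmt-ValiantsHypothesis-15046-c1-0, cycle 2 (2026-08-16).  No definitions,
no named facts; Mathlib + tree only.
-/

noncomputable section

-- `Summit.ValiantsHypothesis.ValiantsHypothesis.…` is the tree's mandated single-conjunct layout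
-- (Problem = Summit), so the duplicated namespace component is intended.
set_option linter.dupNamespace false

namespace Summit.ValiantsHypothesis.ValiantsHypothesis.Theorems.DivisionGap.PerCofactorDegreeReduction.Window

open MvPolynomial Literature.Computability.AlgebraicComplexity
open Summit.ValiantsHypothesis.Theorems.PerCofactorDegreeReductionNegative (lt_two_pow_qp qp_mono)
open scoped NNReal BigOperators

/-! ### The two windows give the two halves -/

/-- **K1 from its window** (`stub_creationDegreeWindow` + the provable engines
`stub_bottomComponentFree`, `stub_monomialStripping`, `stub_contentSplit` + the tree's free
multihomogeneous normal form): the unrestricted creation-degree statement K1 of cycle 1.  Regimes: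
(H) `L(per_n) ≤ B ⇒ A := per_n`; (O) bottom slice `h♭` of the cofactor with `n + deg h♭ ≤ B ⇒
A := per_n · h♭` (free); then single-type `h♭` (free) and split off its monomial content
`h₁ = x^M h₂` (`L(per_n h₂) ≤ poly(n, s)`); (O') `n + deg h₂ ≤ B ⇒ A := per_n · h₂`; (R) otherwise
`h₂` is in the window and the stub applies; `qp_absorb` does the bookkeeping. -/
theorem creationDegree_of_window (hK1W : (∃ k : ℕ, ∀ (n : ℕ) (h : MvPolynomial (Fin n × Fin n) ℝ≥0), h ≠ 0 →
        (∃ τ : (Fin n →₀ ℕ) × (Fin n →₀ ℕ),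
            ∀ m ∈ h.support, (Finsupp.mapDomain Prod.fst m, Finsupp.mapDomain Prod.snd m) = τ) →
        (∀ v : Fin n × Fin n, ∃ m ∈ h.support, m v = 0) →
        2 ^ ((Nat.log 2 n + Nat.log 2 (complexity (perPoly (Fin n) ℝ≥0 * h)) + k) ^ k) <
          complexity (perPoly (Fin n) ℝ≥0) →
        2 ^ ((Nat.log 2 n + Nat.log 2 (complexity (perPoly (Fin n) ℝ≥0 * h)) + k) ^ k) <
          h.totalDegree →
        ∃ A : MvPolynomial (Fin n × Fin n) ℝ≥0, A ≠ 0 ∧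
          perPoly (Fin n) ℝ ∣ MvPolynomial.map NNReal.toRealHom A ∧
          A.totalDegree ≤
            2 ^ ((Nat.log 2 n + Nat.log 2 (complexity (perPoly (Fin n) ℝ≥0 * h)) + k) ^ k) ∧
          complexity A ≤
            2 ^ ((Nat.log 2 n + Nat.log 2 (complexity (perPoly (Fin n) ℝ≥0 * h)) + k) ^ k))) :
    ∃ k : ℕ, ∀ (n : ℕ) (g : MvPolynomial (Fin n × Fin n) ℝ≥0), g ≠ 0 →
      perPoly (Fin n) ℝ≥0 ∣ g →
      ∃ A : MvPolynomial (Fin n × Fin n) ℝ≥0, A ≠ 0 ∧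
        perPoly (Fin n) ℝ ∣ MvPolynomial.map NNReal.toRealHom A ∧
        A.totalDegree ≤ 2 ^ ((Nat.log 2 n + Nat.log 2 (complexity g) + k) ^ k) ∧
        complexity A ≤ 2 ^ ((Nat.log 2 n + Nat.log 2 (complexity g) + k) ^ k) := by
  classical
  obtain ⟨k, hk⟩ := hK1W
  obtain ⟨c, hc⟩ :=
    Summit.ValiantsHypothesis.ValiantsHypothesis.Theorems.DivisionGap.PerCofactorDegreeReduction.MonomialStripping.stub_monomialStripping
  obtain ⟨K, hK1, hK⟩ := qp_absorb c k
  refine ⟨K, fun n g hg hdvd => ?_⟩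
  obtain ⟨h, rfl⟩ := hdvd
  have hh : h ≠ 0 := by rintro rfl; exact hg (mul_zero _)
  set s := complexity (perPoly (Fin n) ℝ≥0 * h) with hs
  have hdegper : (perPoly (Fin n) ℝ≥0).totalDegree = n := by
    simpa using (totalDegree_perPoly_holds (n := Fin n) (k := ℝ≥0))
  have hperdvd : ∀ p : MvPolynomial (Fin n × Fin n) ℝ≥0,
      perPoly (Fin n) ℝ ∣ MvPolynomial.map NNReal.toRealHom (perPoly (Fin n) ℝ≥0 * p) := fun p => by
    rw [map_mul, map_perPoly]; exact dvd_mul_right _ _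
  have hnB : n ≤ 2 ^ ((Nat.log 2 n + Nat.log 2 s + K) ^ K) := (lt_two_pow_qp n _ K hK1).le
  have hsB : s ≤ 2 ^ ((Nat.log 2 n + Nat.log 2 s + K) ^ K) := self_le_two_pow_qp s _ K hK1
  -- (H) the hard regime
  by_cases hH : complexity (perPoly (Fin n) ℝ≥0) ≤ 2 ^ ((Nat.log 2 n + Nat.log 2 s + K) ^ K)
  · refine ⟨perPoly (Fin n) ℝ≥0, perPoly_ne_zero _ _, ⟨1, by rw [map_perPoly, mul_one]⟩, ?_, hH⟩
    rw [hdegper]; exact hnB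
  push Not at hH
  -- (O) the bottom slice
  obtain ⟨d, hb, hb0, hbhom, hbsub, hbdeg, hLb⟩ := exists_bottom_slice h hh
  by_cases hO : n + d ≤ 2 ^ ((Nat.log 2 n + Nat.log 2 s + K) ^ K)
  · refine ⟨perPoly (Fin n) ℝ≥0 * hb, mul_ne_zero (perPoly_ne_zero _ _) hb0, hperdvd hb, ?_,
      hLb.trans hsB⟩
    calc (perPoly (Fin n) ℝ≥0 * hb).totalDegree
        ≤ (perPoly (Fin n) ℝ≥0).totalDegree + hb.totalDegree := totalDegree_mul _ _
      _ = n + d := by rw [hdegper, hbdeg]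
      _ ≤ _ := hO
  push Not at hO
  -- single-typing (free)
  obtain ⟨h₁, h₁0, h₁sub, ⟨τ, hτ⟩, hL₁, -⟩ :=
    Summit.ValiantsHypothesis.ValiantsHypothesis.Theorems.DivisionGap.PerMultiplesHard.NormalForm.stub_multihomogeneousNormalForm
      n hb hb0
  -- content splitting
  obtain ⟨M, h₂, hMh₂, hfree, hsupp₂⟩ :=
    Summit.ValiantsHypothesis.ValiantsHypothesis.Theorems.DivisionGap.PerCofactorDegreeReduction.ContentSplit.stub_contentSplit n h₁ h₁0
  have h₂0 : h₂ ≠ 0 := by rintro rfl; exact h₁0 (by rw [← hMh₂, mul_zero])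
  have hL₂ : complexity (perPoly (Fin n) ℝ≥0 * h₂) ≤ c * (n + 1) ^ c * (s + 1) ^ c := by
    refine (hc n M (perPoly (Fin n) ℝ≥0 * h₂)).trans ?_
    have : monomial M 1 * (perPoly (Fin n) ℝ≥0 * h₂) = perPoly (Fin n) ℝ≥0 * h₁ := by
      rw [mul_left_comm, hMh₂]
    rw [this]
    gcongr
    exact hL₁.trans hLb
  obtain ⟨hKa, hKb⟩ := hK n s _ hL₂
  by_cases hO₂ : n + h₂.totalDegree ≤ 2 ^ ((Nat.log 2 n + Nat.log 2 s + K) ^ K)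
  · refine ⟨perPoly (Fin n) ℝ≥0 * h₂, mul_ne_zero (perPoly_ne_zero _ _) h₂0, hperdvd h₂, ?_,
      hL₂.trans hKb⟩
    calc (perPoly (Fin n) ℝ≥0 * h₂).totalDegree
        ≤ (perPoly (Fin n) ℝ≥0).totalDegree + h₂.totalDegree := totalDegree_mul _ _
      _ = n + h₂.totalDegree := by rw [hdegper]
      _ ≤ _ := hO₂
  push Not at hO₂
  -- (R) the window
  have htyped : ∃ τ₂ : (Fin n →₀ ℕ) × (Fin n →₀ ℕ), ∀ m ∈ h₂.support,
      (Finsupp.mapDomain Prod.fst m, Finsupp.mapDomain Prod.snd m) = τ₂ := by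
    refine ⟨(τ.1 - Finsupp.mapDomain Prod.fst M, τ.2 - Finsupp.mapDomain Prod.snd M),
      fun x hx => ?_⟩
    obtain ⟨m, hm, hMm, rfl⟩ := hsupp₂ x hx
    have hmt := hτ m hm
    have h1 : Finsupp.mapDomain Prod.fst m = τ.1 := by rw [← hmt]
    have h2 : Finsupp.mapDomain Prod.snd m = τ.2 := by rw [← hmt]
    have hsplit : m = M + (m - M) := (add_tsub_cancel_of_le hMm).symm
    refine Prod.ext ?_ ?_
    · show Finsupp.mapDomain Prod.fst (m - M) = τ.1 - Finsupp.mapDomain Prod.fst M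
      rw [← h1]
      conv_rhs => rw [hsplit, Finsupp.mapDomain_add]
      rw [add_tsub_cancel_left]
    · show Finsupp.mapDomain Prod.snd (m - M) = τ.2 - Finsupp.mapDomain Prod.snd M
      rw [← h2]
      conv_rhs => rw [hsplit, Finsupp.mapDomain_add]
      rw [add_tsub_cancel_left]
  have hexp : 2 ^ ((Nat.log 2 n + Nat.log 2 (complexity (perPoly (Fin n) ℝ≥0 * h₂)) + k) ^ k) <
      complexity (perPoly (Fin n) ℝ≥0) := by omega
  have hdeg : 2 ^ ((Nat.log 2 n + Nat.log 2 (complexity (perPoly (Fin n) ℝ≥0 * h₂)) + k) ^ k) <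
      h₂.totalDegree := by omega
  obtain ⟨A, hA0, hAdvd, hAdeg, hAL⟩ := hk n h₂ h₂0 htyped hfree hexp hdeg
  exact ⟨A, hA0, hAdvd, by omega, by omega⟩

/-- **K2 from its window**: outside the sub-exponential regime the permanent itself is a
positivizer (`per_n · q = A ≥ 0`, degree `n`). -/
theorem cheapPositivization_of_window (hK2W : (∃ k : ℕ, ∀ (n : ℕ) (A : MvPolynomial (Fin n × Fin n) ℝ≥0) (q : MvPolynomial (Fin n × Fin n) ℝ),
        A ≠ 0 → MvPolynomial.map NNReal.toRealHom A = perPoly (Fin n) ℝ * q →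
        (∃ m, coeff m q < 0) → n + 2 ≤ q.totalDegree →
        2 ^ ((Nat.log 2 n + Nat.log 2 (complexity A) + Nat.log 2 A.totalDegree + k) ^ k) <
          complexity (perPoly (Fin n) ℝ≥0) →
        ∃ p : MvPolynomial (Fin n × Fin n) ℝ≥0, p ≠ 0 ∧
          (∀ m, 0 ≤ coeff m (MvPolynomial.map NNReal.toRealHom p * q)) ∧
          p.totalDegree ≤
            2 ^ ((Nat.log 2 n + Nat.log 2 (complexity A) + Nat.log 2 A.totalDegree + k) ^ k) ∧
          complexity p ≤
            2 ^ ((Nat.log 2 n + Nat.log 2 (complexity A) + Nat.log 2 A.totalDegree + k) ^ k))) :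
    ∃ k : ℕ, ∀ (n : ℕ) (A : MvPolynomial (Fin n × Fin n) ℝ≥0) (q : MvPolynomial (Fin n × Fin n) ℝ),
      A ≠ 0 → MvPolynomial.map NNReal.toRealHom A = perPoly (Fin n) ℝ * q →
      (∃ m, coeff m q < 0) → n + 2 ≤ q.totalDegree →
      ∃ p : MvPolynomial (Fin n × Fin n) ℝ≥0, p ≠ 0 ∧
        (∀ m, 0 ≤ coeff m (MvPolynomial.map NNReal.toRealHom p * q)) ∧
        p.totalDegree ≤
          2 ^ ((Nat.log 2 n + Nat.log 2 (complexity A) + Nat.log 2 A.totalDegree + k) ^ k) ∧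
        complexity p ≤
          2 ^ ((Nat.log 2 n + Nat.log 2 (complexity A) + Nat.log 2 A.totalDegree + k) ^ k) := by
  classical
  obtain ⟨k, hk⟩ := hK2W
  refine ⟨max k 1, fun n A q hA hAq hneg hdeg => ?_⟩
  have hmono : 2 ^ ((Nat.log 2 n + Nat.log 2 (complexity A) + Nat.log 2 A.totalDegree + k) ^ k) ≤
      2 ^ ((Nat.log 2 n + Nat.log 2 (complexity A) + Nat.log 2 A.totalDegree + max k 1) ^ max k 1) :=
    Nat.pow_le_pow_right two_pos (qp_mono (le_max_left _ _) (le_max_right _ _))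
  by_cases hW : 2 ^ ((Nat.log 2 n + Nat.log 2 (complexity A) + Nat.log 2 A.totalDegree + k) ^ k) <
      complexity (perPoly (Fin n) ℝ≥0)
  · obtain ⟨p, hp0, hpq, hpdeg, hpL⟩ := hk n A q hA hAq hneg hdeg hW
    exact ⟨p, hp0, hpq, hpdeg.trans hmono, hpL.trans hmono⟩
  · push Not at hW
    refine ⟨perPoly (Fin n) ℝ≥0, perPoly_ne_zero _ _, fun m => ?_, ?_, hW.trans hmono⟩
    · rw [map_perPoly, ← hAq, coeff_map]
      exact NNReal.coe_nonneg _
    · rw [totalDegree_perPoly_holds, Fintype.card_fin]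
      have := lt_two_pow_qp n (Nat.log 2 (complexity A) + Nat.log 2 A.totalDegree) (max k 1)
        (le_max_right _ _)
      rw [← add_assoc] at this
      exact this.le

/-! ### The composition -/

/-- **K1|window ∧ K2|window ⇒ the crux** (the kernel-checked composition of line `Sketch`, with
its two open stubs as hypotheses): `k₁` from K1, `k₂` from K2, `K := qp_glue k₁ k₂`; K1 on
`g = per·h` gives a cheap nonnegative `A ∈ (per)` of low degree with real cofactor `q`; if `q ≥ 0`
then `h' := q`; else `deg q ≥ n + 2` by `stub_automaticPositivity` and K2 positivizes:
`h' := q·p`, `per·h' = A·p`. [prime-walk-positivizer, Assembly] -/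
theorem perCofactorDegreeReduction_of_windows (hK1W : (∃ k : ℕ, ∀ (n : ℕ) (h : MvPolynomial (Fin n × Fin n) ℝ≥0), h ≠ 0 →
        (∃ τ : (Fin n →₀ ℕ) × (Fin n →₀ ℕ),
            ∀ m ∈ h.support, (Finsupp.mapDomain Prod.fst m, Finsupp.mapDomain Prod.snd m) = τ) →
        (∀ v : Fin n × Fin n, ∃ m ∈ h.support, m v = 0) →
        2 ^ ((Nat.log 2 n + Nat.log 2 (complexity (perPoly (Fin n) ℝ≥0 * h)) + k) ^ k) <
          complexity (perPoly (Fin n) ℝ≥0) →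
        2 ^ ((Nat.log 2 n + Nat.log 2 (complexity (perPoly (Fin n) ℝ≥0 * h)) + k) ^ k) <
          h.totalDegree →
        ∃ A : MvPolynomial (Fin n × Fin n) ℝ≥0, A ≠ 0 ∧
          perPoly (Fin n) ℝ ∣ MvPolynomial.map NNReal.toRealHom A ∧
          A.totalDegree ≤
            2 ^ ((Nat.log 2 n + Nat.log 2 (complexity (perPoly (Fin n) ℝ≥0 * h)) + k) ^ k) ∧
          complexity A ≤
            2 ^ ((Nat.log 2 n + Nat.log 2 (complexity (perPoly (Fin n) ℝ≥0 * h)) + k) ^ k)))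
    (hK2W : (∃ k : ℕ, ∀ (n : ℕ) (A : MvPolynomial (Fin n × Fin n) ℝ≥0) (q : MvPolynomial (Fin n × Fin n) ℝ),
        A ≠ 0 → MvPolynomial.map NNReal.toRealHom A = perPoly (Fin n) ℝ * q →
        (∃ m, coeff m q < 0) → n + 2 ≤ q.totalDegree →
        2 ^ ((Nat.log 2 n + Nat.log 2 (complexity A) + Nat.log 2 A.totalDegree + k) ^ k) <
          complexity (perPoly (Fin n) ℝ≥0) →
        ∃ p : MvPolynomial (Fin n × Fin n) ℝ≥0, p ≠ 0 ∧
          (∀ m, 0 ≤ coeff m (MvPolynomial.map NNReal.toRealHom p * q)) ∧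
          p.totalDegree ≤
            2 ^ ((Nat.log 2 n + Nat.log 2 (complexity A) + Nat.log 2 A.totalDegree + k) ^ k) ∧
          complexity p ≤
            2 ^ ((Nat.log 2 n + Nat.log 2 (complexity A) + Nat.log 2 A.totalDegree + k) ^ k))) :
    Summit.ValiantsHypothesis.ValiantsHypothesis.Theses.DivisionGap.PerCofactorDegreeReduction := by
  classical
  obtain ⟨k₁, hK1⟩ := creationDegree_of_window hK1W
  obtain ⟨k₂, hK2⟩ := cheapPositivization_of_window hK2W
  obtain ⟨K, hK⟩ := qp_glue k₁ k₂
  refine ⟨K, ?_⟩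
  intro n h hh
  obtain ⟨s, hs⟩ : ∃ s, s = complexity (perPoly (Fin n) ℝ≥0 * h) := ⟨_, rfl⟩
  rw [← hs]
  have hmapper : MvPolynomial.map NNReal.toRealHom (perPoly (Fin n) ℝ≥0) = perPoly (Fin n) ℝ :=
    map_perPoly _
  -- K1 on `g = per · h`
  have hg0 : perPoly (Fin n) ℝ≥0 * h ≠ 0 := mul_ne_zero (perPoly_ne_zero _ _) hh
  obtain ⟨A, hA0, hAdvd, hAdeg, hAL⟩ := hK1 n (perPoly (Fin n) ℝ≥0 * h) hg0 (dvd_mul_right _ _)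
  rw [← hs] at hAdeg hAL
  obtain ⟨q, hq⟩ := hAdvd
  have hmapA0 : MvPolynomial.map NNReal.toRealHom A ≠ 0 := fun h0 =>
    hA0 (map_toRealHom_injective (by rw [h0, map_zero]))
  have hq0 : q ≠ 0 := by
    rintro rfl
    exact hmapA0 (by rw [hq, mul_zero])
  have hperR0 : perPoly (Fin n) ℝ ≠ 0 := perPoly_ne_zero _ _
  -- `deg q ≤ deg A`
  have hdegq : q.totalDegree ≤ A.totalDegree := by
    have h1 : (MvPolynomial.map NNReal.toRealHom A).totalDegree =
        (perPoly (Fin n) ℝ).totalDegree + q.totalDegree := by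
      rw [hq]; exact totalDegree_mul_of_isDomain hperR0 hq0
    rw [totalDegree_map_toRealHom] at h1
    omega
  -- logarithms of `L(A)` and `deg A`
  have hlogB : ∀ x : ℕ, x ≤ 2 ^ ((Nat.log 2 n + Nat.log 2 s + k₁) ^ k₁) →
      Nat.log 2 x ≤ (Nat.log 2 n + Nat.log 2 s + k₁) ^ k₁ := by
    intro x hx
    calc Nat.log 2 x ≤ Nat.log 2 (2 ^ ((Nat.log 2 n + Nat.log 2 s + k₁) ^ k₁)) :=
          Nat.log_mono_right hx
      _ = (Nat.log 2 n + Nat.log 2 s + k₁) ^ k₁ := Nat.log_pow one_lt_two _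
  have harith :
      2 ^ ((Nat.log 2 n + Nat.log 2 s + k₁) ^ k₁) +
        2 ^ ((Nat.log 2 n + Nat.log 2 (complexity A) + Nat.log 2 A.totalDegree + k₂) ^ k₂) + 1 ≤
      2 ^ ((Nat.log 2 n + Nat.log 2 s + K) ^ K) :=
    hK (Nat.log 2 n + Nat.log 2 s) (Nat.log 2 n) (Nat.log 2 (complexity A))
      (Nat.log 2 A.totalDegree) (Nat.le_add_right _ _) (hlogB _ hAL) (hlogB _ hAdeg)
  have hB1F : 2 ^ ((Nat.log 2 n + Nat.log 2 s + k₁) ^ k₁) ≤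
      2 ^ ((Nat.log 2 n + Nat.log 2 s + K) ^ K) :=
    le_trans (le_trans (Nat.le_add_right _ _) (Nat.le_add_right _ _)) harith
  by_cases hqpos : ∀ m, 0 ≤ coeff m q
  · -- the real cofactor is already nonnegative: `h' := q`
    obtain ⟨h', hh'⟩ := exists_lift_of_coeff_nonneg q hqpos
    have hprod : perPoly (Fin n) ℝ≥0 * h' = A := by
      apply map_toRealHom_injective
      rw [map_mul, hmapper, hh', hq]
    refine ⟨h', ?_, ?_, ?_⟩
    · rintro rfl
      exact hq0 (by rw [← hh', map_zero])
    · have h1 : h'.totalDegree = q.totalDegree := by rw [← hh', totalDegree_map_toRealHom]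
      calc h'.totalDegree ≤ A.totalDegree := by omega
        _ ≤ 2 ^ ((Nat.log 2 n + Nat.log 2 s + k₁) ^ k₁) := hAdeg
        _ ≤ 2 ^ ((Nat.log 2 n + Nat.log 2 s + K) ^ K) := hB1F
    · rw [hprod]
      exact hAL.trans hB1F
  · -- the real cofactor is signed: positivise it (K2) — the window `deg q ≥ n + 2` is automatic
    push Not at hqpos
    have hdeg : n + 2 ≤ q.totalDegree := by
      by_contra hlt
      push Not at hlt
      obtain ⟨m, hm⟩ := hqpos
      have hall : ∀ m, 0 ≤ coeff m (perPoly (Fin n) ℝ * q) := fun m => by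
        rw [← hq]; exact coeff_map_toRealHom_nonneg A m
      have := Summit.ValiantsHypothesis.ValiantsHypothesis.Theorems.DivisionGap.PerCofactorDegreeReduction.AutomaticPositivity.stub_automaticPositivity n q (by omega) hall m
      linarith
    obtain ⟨p, hp0, hpq, hpdeg, hpL⟩ := hK2 n A q hA0 hq hqpos hdeg
    obtain ⟨h', hh'⟩ := exists_lift_of_coeff_nonneg _ hpq
    have hmapp0 : MvPolynomial.map NNReal.toRealHom p ≠ 0 := fun h0 =>
      hp0 (map_toRealHom_injective (by rw [h0, map_zero]))
    have hprod : perPoly (Fin n) ℝ≥0 * h' = p * A := by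
      apply map_toRealHom_injective
      rw [map_mul, map_mul, hmapper, hh', hq]
      ring
    refine ⟨h', ?_, ?_, ?_⟩
    · rintro rfl
      rw [map_zero] at hh'
      exact (mul_ne_zero hmapp0 hq0) hh'.symm
    · have h1 : h'.totalDegree = (MvPolynomial.map NNReal.toRealHom p * q).totalDegree := by
        rw [← hh', totalDegree_map_toRealHom]
      have h2 : (MvPolynomial.map NNReal.toRealHom p * q).totalDegree ≤
          p.totalDegree + q.totalDegree := by
        calc (MvPolynomial.map NNReal.toRealHom p * q).totalDegree
            ≤ (MvPolynomial.map NNReal.toRealHom p).totalDegree + q.totalDegree :=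
              totalDegree_mul _ _
          _ = p.totalDegree + q.totalDegree := by rw [totalDegree_map_toRealHom]
      calc h'.totalDegree ≤ p.totalDegree + A.totalDegree := by omega
        _ ≤ 2 ^ ((Nat.log 2 n + Nat.log 2 (complexity A) + Nat.log 2 A.totalDegree + k₂) ^ k₂) +
            2 ^ ((Nat.log 2 n + Nat.log 2 s + k₁) ^ k₁) := Nat.add_le_add hpdeg hAdeg
        _ ≤ 2 ^ ((Nat.log 2 n + Nat.log 2 s + K) ^ K) := by omega
    · rw [hprod]
      calc complexity (p * A) ≤ complexity p + complexity A + 1 := complexity_mul_le_holds p A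
        _ ≤ 2 ^ ((Nat.log 2 n + Nat.log 2 (complexity A) + Nat.log 2 A.totalDegree + k₂) ^ k₂) +
            2 ^ ((Nat.log 2 n + Nat.log 2 s + k₁) ^ k₁) + 1 :=
          Nat.add_le_add_right (Nat.add_le_add hpL hAL) 1
        _ ≤ 2 ^ ((Nat.log 2 n + Nat.log 2 s + K) ^ K) := by omega

end Summit.ValiantsHypothesis.ValiantsHypothesis.Theorems.DivisionGap.PerCofactorDegreeReduction.Window

end
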